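import Mathlib
import Literature.Analysis.FluidPDE.SelfSimilarCollapseAnsatz
import Literature.Analysis.FluidPDE.ForwardDSSExistenceLocalProofs
import HarnessLib

/-!
# Crux E `PowerGaugeEulerLiouville` (stmt-NavierStokesRegularity-19832): a scale-invariant pressure class IS a self-similar ansatz
# (lane «pressure slaving», the measure-theoretic extraction step; LEAD ns-typeII-p2 g11 10:28:47Z (a); width seat ns-ezl-w3 g2)

Route `EulerZoomLiouville` (NavierStokesRegularity), crux E = Seregin's power-gauged ancient Euler class.  Pure measure theory, no
fluid mechanics: let `p` be a.e.-strongly measurable on the slab `(−∞,0) × ℝ³` and A.E.-INVARIANT under every member of the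
one-parameter group of self-similar rescalings of rate `g`,
`p(s, y) = β^{2(1−g)} p(β s, β^{g} y)` for a.e. `(s, y)`, for every `β > 0`.
Then there is a measurable profile `Q : ℝ³ → ℝ` with `p(s, ·) = (−s)^{2(g−1)} Q((−s)^{−g} ·)` a.e. on `ℝ³` for a.e. `s < 0`, i.e.
`p(s) = selfSimilarCollapsePressure g 0 Q s` a.e., for a.e. `s` (`PressureSlaving.exists_profile_of_scaleInvariant`).

Proof (`Φ(s, x) = (−s)^{2(1−g)} p(s, (−s)^{g} x)` is the profile read off at time `s`; invariance says `Φ(βs, ·) = Φ(s, ·)` a.e.,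
for each `β`): a strongly measurable modification makes all sets measurable; Fubini in `(β, s, x)` (`Measure.ae_ae_comm`) gives, for
a.e. `(s, x)`, `Φ(βs, x) = Φ(s, x)` for a.e. `β > 0`, i.e. (the dilation `β ↦ βs` is quasi-measure-preserving) `Φ(σ, x) = Φ(s, x)` for
a.e. `σ < 0`; Fubini once more yields ONE good time `σ₀` with `Φ(s, x) = Φ(σ₀, x)` for a.e. `(s, x)`, and `Q = Φ(σ₀, ·)`.

* `PressureSlaving.quasiMeasurePreserving_selfSimilarMap` — the dilation used (with the tree's `quasiMeasurePreserving_mul_left`);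
* `PressureSlaving.ae_Iio_of_ae_Ioi_mul` — transport of a.e. statements along `β ↦ β s` (`s < 0`);
* `PressureSlaving.exists_profile_of_scaleInvariant` — the extraction.

WHAT THIS IS NOT: not NS regularity, not the crux E — measure-theoretic bookkeeping for the census of the crux CLASS 19832 on the
MODEL lattice; `--supports` stmt-19832. [folklore]
-/

noncomputable section

-- flat `Theorems/<Route><Decl>…` files of one crux share the namespace of the crux (tree convention: `Summit.<S>.<S>.…`)
set_option linter.dupNamespace false

open MeasureTheory Set Filter Topology Metric Function TopologicalSpace
open scoped ENNReal NNReal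

namespace Summit.NavierStokesRegularity.NavierStokesRegularity.Theorems.PowerGaugeEulerLiouville

open Literature.Analysis Literature.Analysis.FunctionSpaces Literature.Analysis.FluidPDE

namespace PressureSlaving

/-! ### Dilations are quasi-measure-preserving -/

/-- The self-similar map `(s, y) ↦ (β s, c • y)` (`β, c ≠ 0`) is quasi-measure-preserving for Lebesgue measure on `ℝ × ℝ³`. [folklore] -/
theorem quasiMeasurePreserving_selfSimilarMap {β c : ℝ} (hβ : β ≠ 0) (hc : c ≠ 0) :
    Measure.QuasiMeasurePreserving
      (fun z : ℝ × EuclideanSpace ℝ (Fin 3) => (β * z.1, c • z.2)) volume volume := by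
  have h := MeasureTheory.QuasiMeasurePreserving.prodMap (quasiMeasurePreserving_mul_left hβ)
    (Measure.quasiMeasurePreserving_smul (volume : Measure (EuclideanSpace ℝ (Fin 3))) hc)
  rw [← Measure.volume_eq_prod] at h
  exact h

/-- **Transport along `β ↦ β s`.**  For `s < 0`: if `P (β s)` holds for a.e. `β > 0`, then `P σ` holds for a.e. `σ < 0`
(the dilation `σ ↦ s⁻¹ σ` is quasi-measure-preserving and maps `(−∞,0)` onto `(0,∞)`). [folklore] -/
theorem ae_Iio_of_ae_Ioi_mul {s : ℝ} (hs : s < 0) {P : ℝ → Prop}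
    (h : ∀ᵐ β ∂(volume.restrict (Ioi (0 : ℝ))), P (β * s)) :
    ∀ᵐ σ ∂(volume.restrict (Iio (0 : ℝ))), P σ := by
  have h' : ∀ᵐ β ∂(volume : Measure ℝ), β ∈ Ioi (0 : ℝ) → P (β * s) := (ae_restrict_iff' measurableSet_Ioi).1 h
  have hq := quasiMeasurePreserving_mul_left (inv_ne_zero hs.ne)
  refine (ae_restrict_iff' measurableSet_Iio).2 ?_
  filter_upwards [hq.ae h'] with σ hσ hσneg
  have hpos : s⁻¹ * σ ∈ Ioi (0 : ℝ) := mul_pos_of_neg_of_neg (inv_lt_zero.2 hs) hσneg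
  have e : s⁻¹ * σ * s = σ := by rw [mul_comm, ← mul_assoc, mul_inv_cancel₀ hs.ne, one_mul]
  have := hσ hpos
  rwa [e] at this

/-! ### The extraction -/

/-- Lebesgue measure restricted to the slab is the product of the restricted time measure and Lebesgue measure on `ℝ³`. [folklore] -/
theorem volume_restrict_slab_eq_prod :
    ((volume : Measure (ℝ × EuclideanSpace ℝ (Fin 3))).restrict
        (Iio (0 : ℝ) ×ˢ (univ : Set (EuclideanSpace ℝ (Fin 3))))) =
      ((volume : Measure ℝ).restrict (Iio 0)).prod (volume : Measure (EuclideanSpace ℝ (Fin 3))) := by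
  rw [Measure.volume_eq_prod, ← Measure.prod_restrict, Measure.restrict_univ]

/-- **A SCALE-INVARIANT PRESSURE CLASS IS A SELF-SIMILAR ANSATZ.**  Let `p` be a.e.-strongly measurable on the slab
`(−∞,0) × ℝ³` and suppose that for every `β > 0`, `p(s, y) = (β^{1−g})² p(β s, β^{g} y)` for a.e. `(s, y)` in the slab.  Then there is
a measurable `Q : ℝ³ → ℝ` with `p(s) = selfSimilarCollapsePressure g 0 Q s` a.e. on `ℝ³`, i.e. `p(s, y) = (−s)^{2(g−1)} Q((−s)^{−g} y)`
for a.e. `y`, for a.e. `s < 0`. [folklore] -/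
theorem exists_profile_of_scaleInvariant {g : ℝ} {p : ℝ → EuclideanSpace ℝ (Fin 3) → ℝ}
    (hpm : AEStronglyMeasurable (uncurry p)
      (volume.restrict (Iio (0 : ℝ) ×ˢ (univ : Set (EuclideanSpace ℝ (Fin 3))))))
    (hinv : ∀ β : ℝ, 0 < β → ∀ᵐ z ∂(volume.restrict (Iio (0 : ℝ) ×ˢ (univ : Set (EuclideanSpace ℝ (Fin 3))))),
      p z.1 z.2 = (β ^ (1 - g)) ^ 2 * p (β * z.1) (β ^ g • z.2)) :
    ∃ Q : EuclideanSpace ℝ (Fin 3) → ℝ, Measurable Q ∧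
      ∀ᵐ s ∂(volume.restrict (Iio (0 : ℝ))), p s =ᵐ[volume] selfSimilarCollapsePressure g 0 Q s := by
  -- ### notation and the strongly measurable modification
  set S : Set (ℝ × EuclideanSpace ℝ (Fin 3)) := Iio (0 : ℝ) ×ˢ (univ : Set (EuclideanSpace ℝ (Fin 3))) with hS
  have hSm : MeasurableSet S := measurableSet_Iio.prod MeasurableSet.univ
  set μT : Measure ℝ := (volume : Measure ℝ).restrict (Iio 0) with hμT
  set μ : Measure (ℝ × EuclideanSpace ℝ (Fin 3)) := μT.prod (volume : Measure (EuclideanSpace ℝ (Fin 3))) with hμ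
  have hμS : (volume : Measure (ℝ × EuclideanSpace ℝ (Fin 3))).restrict S = μ := volume_restrict_slab_eq_prod
  set pt : ℝ × EuclideanSpace ℝ (Fin 3) → ℝ := hpm.mk (uncurry p) with hpt
  have hptm : Measurable pt := hpm.stronglyMeasurable_mk.measurable
  have hppt : ∀ᵐ z ∂(volume.restrict S), uncurry p z = pt z := hpm.ae_eq_mk
  have hppt' : ∀ᵐ z ∂(volume : Measure (ℝ × EuclideanSpace ℝ (Fin 3))), z ∈ S → uncurry p z = pt z :=
    (ae_restrict_iff' hSm).1 hppt
  -- ### invariance of the modification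
  have hinvt : ∀ β : ℝ, 0 < β → ∀ᵐ z ∂μ, pt z = (β ^ (1 - g)) ^ 2 * pt (β * z.1, β ^ g • z.2) := by
    intro β hβ
    have hq := quasiMeasurePreserving_selfSimilarMap (c := β ^ g) hβ.ne' (Real.rpow_pos_of_pos hβ g).ne'
    have h2 : ∀ᵐ z ∂(volume : Measure (ℝ × EuclideanSpace ℝ (Fin 3))),
        (β * z.1, β ^ g • z.2) ∈ S → uncurry p (β * z.1, β ^ g • z.2) = pt (β * z.1, β ^ g • z.2) := hq.ae hppt'
    rw [← hμS]
    refine (ae_restrict_iff' hSm).2 ?_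
    filter_upwards [hppt', h2, (ae_restrict_iff' hSm).1 (hinv β hβ)] with z h1 h2 h3 hz
    have hz' : (β * z.1, β ^ g • z.2) ∈ S := by
      refine mem_prod.2 ⟨?_, mem_univ _⟩
      have : z.1 < 0 := hz.1
      exact mul_neg_of_pos_of_neg hβ this
    have e1 : pt z = p z.1 z.2 := by rw [← h1 hz]; rfl
    have e2 : pt (β * z.1, β ^ g • z.2) = p (β * z.1) (β ^ g • z.2) := by rw [← h2 hz']; rfl
    rw [e1, e2]
    exact h3 hz
  -- ### the profile read off at time `s`
  set Φ : ℝ → EuclideanSpace ℝ (Fin 3) → ℝ := fun s x => (-s) ^ (2 * (1 - g)) * pt (s, (-s) ^ g • x) with hΦ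
  have hΦm : Measurable fun q : ℝ × EuclideanSpace ℝ (Fin 3) => Φ q.1 q.2 := by
    refine (measurable_fst.neg.pow_const _).mul (hptm.comp ?_)
    exact measurable_fst.prodMk ((measurable_fst.neg.pow_const _).smul measurable_snd)
  have hT : ∀ᵐ s ∂μT, s < (0 : ℝ) := ae_restrict_mem measurableSet_Iio
  -- invariance in the `Φ`-picture: `Φ (β s) x = Φ s x` a.e.
  have hΦinv : ∀ β : ℝ, 0 < β → ∀ᵐ s ∂μT, ∀ᵐ x ∂(volume : Measure (EuclideanSpace ℝ (Fin 3))),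
      Φ (β * s) x = Φ s x := by
    intro β hβ
    have h1 := Measure.ae_ae_of_ae_prod (hinvt β hβ)
    filter_upwards [h1, hT] with s hs hs0
    have hns : 0 < -s := neg_pos.2 hs0
    have hc : (-s) ^ g ≠ 0 := (Real.rpow_pos_of_pos hns g).ne'
    have h2 := (Measure.quasiMeasurePreserving_smul (volume : Measure (EuclideanSpace ℝ (Fin 3))) hc).ae hs
    filter_upwards [h2] with x hx
    -- `hx : pt (s, (-s)^g • x) = (β^(1-g))^2 * pt (β * s, β^g • (-s)^g • x)`
    have eβs : -(β * s) = β * (-s) := by ring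
    have hα : (β ^ (1 - g)) ^ 2 = β ^ (2 * (1 - g)) := by
      rw [show (2 : ℝ) * (1 - g) = (1 - g) * ((2 : ℕ) : ℝ) by push_cast; ring, Real.rpow_mul_natCast hβ.le]
    simp only [hΦ]
    rw [eβs, Real.mul_rpow hβ.le hns.le, Real.mul_rpow hβ.le hns.le, mul_smul, hx, hα]
    ring
  -- ### Fubini in `(β, s, x)`
  have hM : MeasurableSet {q : ℝ × (ℝ × EuclideanSpace ℝ (Fin 3)) | Φ (q.1 * q.2.1) q.2.2 = Φ q.2.1 q.2.2} :=
    measurableSet_eq_fun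
      (hΦm.comp ((measurable_fst.mul measurable_snd.fst).prodMk measurable_snd.snd))
      (hΦm.comp measurable_snd)
  have hMβ : ∀ β : ℝ, MeasurableSet {w : ℝ × EuclideanSpace ℝ (Fin 3) | Φ (β * w.1) w.2 = Φ w.1 w.2} := fun β =>
    measurableSet_eq_fun (hΦm.comp ((measurable_fst.const_mul β).prodMk measurable_snd)) hΦm
  have h3 : ∀ᵐ β ∂((volume : Measure ℝ).restrict (Ioi 0)), ∀ᵐ w ∂μ, Φ (β * w.1) w.2 = Φ w.1 w.2 := by
    refine (ae_restrict_iff' measurableSet_Ioi).2 (ae_of_all _ fun β hβ => ?_)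
    exact (Measure.ae_prod_iff_ae_ae (hMβ β)).2 (hΦinv β hβ)
  have h4 : ∀ᵐ w ∂μ, ∀ᵐ β ∂((volume : Measure ℝ).restrict (Ioi 0)), Φ (β * w.1) w.2 = Φ w.1 w.2 :=
    (Measure.ae_ae_comm (μ := (volume : Measure ℝ).restrict (Ioi 0)) (ν := μ)
      (p := fun β w => Φ (β * w.1) w.2 = Φ w.1 w.2) hM).1 h3
  -- ### along the orbit: `Φ σ x = Φ s x` for a.e. `σ < 0`
  have hw1 : ∀ᵐ w ∂μ, w.1 < (0 : ℝ) := by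
    rw [← hμS]
    filter_upwards [ae_restrict_mem hSm] with w hw
    exact hw.1
  have h5 : ∀ᵐ w ∂μ, ∀ᵐ σ ∂μT, Φ σ w.2 = Φ w.1 w.2 := by
    filter_upwards [h4, hw1] with w hw hw0
    exact ae_Iio_of_ae_Ioi_mul (P := fun σ => Φ σ w.2 = Φ w.1 w.2) hw0 hw
  -- ### Fubini once more: one good time `σ₀`
  have hG : MeasurableSet {q : (ℝ × EuclideanSpace ℝ (Fin 3)) × ℝ | Φ q.2 q.1.2 = Φ q.1.1 q.1.2} :=
    measurableSet_eq_fun (hΦm.comp (measurable_snd.prodMk measurable_fst.snd)) (hΦm.comp measurable_fst)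
  have h6 : ∀ᵐ σ ∂μT, ∀ᵐ w ∂μ, Φ σ w.2 = Φ w.1 w.2 :=
    (Measure.ae_ae_comm (μ := μ) (ν := μT) (p := fun w σ => Φ σ w.2 = Φ w.1 w.2) hG).1 h5
  have hμT0 : μT ≠ 0 := by
    rw [hμT, Ne, Measure.restrict_eq_zero, Real.volume_Iio]
    exact ENNReal.top_ne_zero
  haveI : (ae μT).NeBot := ae_neBot.2 hμT0
  obtain ⟨σ₀, hσ₀⟩ := h6.exists
  refine ⟨fun x => Φ σ₀ x, hΦm.comp (measurable_const.prodMk measurable_id), ?_⟩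
  -- ### back to `p`
  have h7 : ∀ᵐ s ∂μT, ∀ᵐ x ∂(volume : Measure (EuclideanSpace ℝ (Fin 3))), Φ σ₀ x = Φ s x :=
    Measure.ae_ae_of_ae_prod hσ₀
  have h8 : ∀ᵐ s ∂μT, ∀ᵐ y ∂(volume : Measure (EuclideanSpace ℝ (Fin 3))), uncurry p (s, y) = pt (s, y) := by
    have h := hppt
    rw [hμS] at h
    exact Measure.ae_ae_of_ae_prod h
  filter_upwards [h7, h8, hT] with s h7s h8s hs0
  have hns : 0 < -s := neg_pos.2 hs0
  have hc : (-s) ^ (-g) ≠ 0 := (Real.rpow_pos_of_pos hns (-g)).ne'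
  have h9 := (Measure.quasiMeasurePreserving_smul (volume : Measure (EuclideanSpace ℝ (Fin 3))) hc).ae h7s
  filter_upwards [h9, h8s] with y hy hpy
  -- `hy : Φ σ₀ ((-s)^(-g) • y) = Φ s ((-s)^(-g) • y)`, `hpy : p s y = pt (s, y)`
  have hcancel : (-s) ^ g • (-s) ^ (-g) • y = y := by
    rw [smul_smul, ← Real.rpow_add hns, add_neg_cancel, Real.rpow_zero, one_smul]
  have hA : (0 : ℝ) < (-s) ^ (2 * (1 - g)) := Real.rpow_pos_of_pos hns _
  have hy' : (-s) ^ (2 * (1 - g)) * pt (s, y) = Φ σ₀ ((-s) ^ (-g) • y) := by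
    rw [hy]
    simp only [hΦ]
    rw [hcancel]
  have hpy' : p s y = pt (s, y) := hpy
  rw [selfSimilarCollapsePressure_apply, zero_sub, hpy', (eq_inv_mul_iff_mul_eq₀ hA.ne').2 hy',
    ← Real.rpow_neg hns.le]
  congr 1
  ring_nf

end PressureSlaving

end Summit.NavierStokesRegularity.NavierStokesRegularity.Theorems.PowerGaugeEulerLiouville

end
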